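/-
Copyright (c) 2026 the pub-hodgecm-mathlib formalisation cell (harness21).  Prover seat hodgecm-mathlib-K2E4-p11 (g8): Track B «K2-LIT»,
#184♮ = hLiu418 = stmt-HodgeConjecture-24832; socket #41 open surface (u-0c), I4 block (desk of record): the GENERIC ALGEBRA CORE of the coset cut of
I3 ED. 2 `K2LiuSiegelMiddleTermKTypesLevel` (K2Liu-p12) — finite-dimensionality is INDUCED along a finite-index subgroup.
THEOREMS ONLY (no `def`, no `instance`, no `notation`, no named-fact hypothesis, no `sorry`).
-/
import Mathlib.LinearAlgebra.FiniteDimensional.Basic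
import Mathlib.GroupTheory.Index
import Mathlib.Data.Complex.Basic
import HarnessLib

/-!
# Crux `HLiu418`, socket #41, (u-0c) I4 block — `K2LiuRightTranslateFiniteIndexSpan`: A FINITE-DIMENSIONAL SPACE OF FUNCTIONS STABLE UNDER RIGHT TRANSLATION BY A
# FINITE-INDEX SUBGROUP GENERATES A FINITE-DIMENSIONAL SPACE STABLE UNDER THE WHOLE GROUP

Cell `hodgecm-mathlib`, crux item hLiu418 = `stmt-HodgeConjecture-24832`; squad K2 ∕ K2Liu (L1, LEAD F0P6-plan (g14)), road `K2_Liu`, socket #41, (u-0c) I4 block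
(K2E4-p11 desk of record; consumer I3 ED. 2 `K2LiuSiegelMiddleTermKTypesLevel`, K2Liu-p12: `G := K_{GL₂}`, `H := Λ⁻¹(𝒦.K) ∩ K_{GL₂}`, `W₀ :=` the span of the coset-wise
`K_H`-type generators).  Lane `--supports stmt-HodgeConjecture-24832 --as helper` (count-neutral helper; closes no socket by itself).

THE MATHEMATICS [BorelJacquet1979, §1.1], [Bump1997, §3.7 (K-finiteness)], [MoeglinWaldspurger1995, I.2.17].  Let `G` be a group, `H ≤ G` of finite index,
`W₀ ≤ (G → ℂ)` finite-dimensional and stable under the right translations `R_t B := (g ↦ B(g t))`, `t ∈ H`.  Choosing right-coset representatives `G = ⊔_r H·k_r`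
(finitely many), **`W := Σ_r R_{k_r} W₀`** is finite-dimensional, contains `W₀`, and is stable under EVERY `R_k`, `k ∈ G`: `R_k R_{k_r} = R_{k_r k}` and
`k_r k = t·k_{r′}` with `t ∈ H`, so `R_{k_r k} W₀ = R_{k_{r′}} R_t W₀ ⊆ R_{k_{r′}} W₀`; moreover every member of `W` is a finite sum of translates `R_k B₀`, `B₀ ∈ W₀`
(so predicates closed under linear combinations pass from the translates of `W₀` to `W`).  No normality of `H` is needed.
* §1 right translation as a linear map (`LinearMap.funLeft`);
* §2 **`exists_finiteDimensional_rightStable`**.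
HONEST LABEL.  Count-neutral helper; it retires nothing by itself: `HC_CM` is proved only modulo the 7 printed citations (2 remaining named inputs:
hLiu418 = `stmt-HodgeConjecture-24832`, h413 = `stmt-HodgeConjecture-24833`) until rung 0 closes.

## References
* [BorelJacquet1979] A. Borel, H. Jacquet, *Automorphic forms and automorphic representations*, Corvallis I (1979), §1.1 (`K`-finite vectors).
* [Bump1997] D. Bump, *Automorphic forms and representations* (1997), §3.7.
* [MoeglinWaldspurger1995] C. Mœglin, J.-L. Waldspurger, *Spectral decomposition and Eisenstein series* (1995), I.2.17.
-/

set_option autoImplicit false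
set_option linter.dupNamespace false -- the mandated namespace repeats `HodgeConjecture.HodgeConjecture`

noncomputable section

namespace Summit.HodgeConjecture.HodgeConjecture.Cruxes.HLiu418.K2LiuRightTranslateFiniteIndexSpan

variable {G : Type*} [Group G]

/-! ## §1 Right translation as a linear map -/

/-- right translation `B ↦ (g ↦ B (g k))` is a linear endomorphism of `G → ℂ` (Mathlib `LinearMap.funLeft`). [cite: Bump1997, §3.7] -/
theorem exists_rightTranslate_linearMap (k : G) : ∃ R : (G → ℂ) →ₗ[ℂ] (G → ℂ), ∀ (B : G → ℂ) (g : G), R B g = B (g * k) :=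
  ⟨LinearMap.funLeft ℂ ℂ (fun g : G => g * k), fun _ _ => rfl⟩

/-! ## §2 Induced finite-dimensionality along a finite-index subgroup -/

/-- **A FINITE-DIMENSIONAL RIGHT-`H`-STABLE SPACE OF FUNCTIONS GENERATES A FINITE-DIMENSIONAL RIGHT-`G`-STABLE SPACE** when `[G : H] < ∞`: there is `W ≤ (G → ℂ)`,
finite-dimensional, containing `W₀`, stable under `B ↦ (g ↦ B (g k))` for EVERY `k ∈ G`, all of whose members are finite linear combinations of translates `g ↦ B₀ (g k)`
(`B₀ ∈ W₀`, `k ∈ G`) — `W := Σ_r R_{k_r} W₀` over right-coset representatives (`k = t·k_r`, `t ∈ H`; `R_k R_{k_r} = R_{k_{r′}} R_{t′}`).  No normality of `H` is used.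
[cite: BorelJacquet1979, §1.1] [cite: Bump1997, §3.7] [cite: MoeglinWaldspurger1995, I.2.17] -/
theorem exists_finiteDimensional_rightStable (H : Subgroup G) [H.FiniteIndex]
    (W₀ : Submodule ℂ (G → ℂ)) [FiniteDimensional ℂ W₀] (hW₀ : ∀ B ∈ W₀, ∀ t : G, t ∈ H → (fun g => B (g * t)) ∈ W₀) :
    ∃ W : Submodule ℂ (G → ℂ), FiniteDimensional ℂ W ∧ W₀ ≤ W ∧
      (∀ B ∈ W, ∀ k : G, (fun g => B (g * k)) ∈ W) ∧
      (∀ B ∈ W, B ∈ Submodule.span ℂ {F : G → ℂ | ∃ (k : G) (B₀ : G → ℂ), B₀ ∈ W₀ ∧ F = fun g => B₀ (g * k)}) := by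
  classical
  -- right translation by `k` as a linear map `R k`
  choose R hR using fun k : G => exists_rightTranslate_linearMap (G := G) k
  have hRfun : ∀ (k : G) (B : G → ℂ), R k B = fun g => B (g * k) := fun k B => funext (hR k B)
  -- `R (a t) = R a ∘ R t` and `g ↦ (R s B) (g k) = R (k s) B`
  have hRmul : ∀ (a t : G) (B : G → ℂ), R (a * t) B = R a (R t B) := fun a t B => by
    rw [hRfun, hRfun, hRfun]
    funext g
    show B (g * (a * t)) = B (g * a * t)
    rw [mul_assoc]
  have hRcomp : ∀ (k s : G) (B : G → ℂ), (fun g => R s B (g * k)) = R (k * s) B := fun k s B => by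
    rw [hRfun, hRfun]
    funext g
    show B (g * k * s) = B (g * (k * s))
    rw [mul_assoc]
  -- left-coset representatives `q.out`: every `x` is `(mk x).out · t` with `t ∈ H`
  have hdec : ∀ x : G, ∃ t : G, t ∈ H ∧ x = (QuotientGroup.mk (s := H) x).out * t := by
    intro x
    obtain ⟨h, hh⟩ := QuotientGroup.mk_out_eq_mul H x
    exact ⟨(h : G)⁻¹, H.inv_mem h.2, by rw [hh, mul_inv_cancel_right]⟩
  -- `W := ⨆_q R (q.out) W₀`
  refine ⟨⨆ q : G ⧸ H, W₀.map (R q.out), inferInstance, ?_, ?_, ?_⟩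
  · -- `W₀ ≤ W`: `B = R_{s} (R_{s⁻¹} B)` with `s = (mk 1).out ∈ H`
    intro B hB
    obtain ⟨t, ht, h1⟩ := hdec (1 : G)
    have hs : (QuotientGroup.mk (s := H) (1 : G)).out = t⁻¹ := eq_inv_of_mul_eq_one_left h1.symm
    refine Submodule.mem_iSup_of_mem (QuotientGroup.mk (s := H) (1 : G)) ⟨R t B, hRfun t B ▸ hW₀ B hB t ht, ?_⟩
    rw [← hRmul, hs, inv_mul_cancel, hRfun]
    funext g
    rw [mul_one]
  · -- right-`G`-stability
    intro B hB k
    induction hB using Submodule.iSup_induction' with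
    | mem q B hBq =>
      obtain ⟨B₀, hB₀, rfl⟩ := hBq
      obtain ⟨t, ht, hx⟩ := hdec (k * q.out)
      rw [hRcomp, hx, hRmul]
      exact Submodule.mem_iSup_of_mem (QuotientGroup.mk (s := H) (k * q.out)) ⟨R t B₀, hRfun t B₀ ▸ hW₀ B₀ hB₀ t ht, rfl⟩
    | zero => exact Submodule.zero_mem _
    | add x y hx hy ihx ihy =>
      have hxy : (fun g => (x + y) (g * k)) = (fun g => x (g * k)) + fun g => y (g * k) := rfl
      rw [hxy]
      exact Submodule.add_mem _ ihx ihy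
  · -- every member is a finite linear combination of translates of `W₀`
    intro B hB
    induction hB using Submodule.iSup_induction' with
    | mem q B hBq =>
      obtain ⟨B₀, hB₀, rfl⟩ := hBq
      exact Submodule.subset_span ⟨q.out, B₀, hB₀, hRfun _ _⟩
    | zero => exact Submodule.zero_mem _
    | add x y hx hy ihx ihy => exact Submodule.add_mem _ ihx ihy

end Summit.HodgeConjecture.HodgeConjecture.Cruxes.HLiu418.K2LiuRightTranslateFiniteIndexSpan

end
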